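import Literature.AlgebraicGeometry.Motives.AbsoluteFlatModel
import Mathlib.LinearAlgebra.TensorProduct.RightExactness
import HarnessLib

/-!
# The absolute flat model: naturality in `R` (transition morphisms `P ×_K Spec R' → P ×_K Spec R`)

Continuation of `Motives/AbsoluteFlatModel` (`absModelHom : Γ(V, 𝒪_P) ⊗_K R → Γ(pr_P⁻¹V, 𝒪_{P ×_K Spec R})`).
For a `K`-algebra map `ψ : R → R'` (structure morphisms `s`, `s'` of `Spec R`, `Spec R'` as in that file):

* `absTransition P s hs s' hs' ψ : P ×_K Spec R' → P ×_K Spec R` (`pullback.map` of `𝟙_P` and `Spec ψ`),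
  its two projections (`absTransition_fst`, `absTransition_snd`), the characterisation by them
  (`absTransition_eq_of`) and `comap_absModelHom`: **pulling `absModelHom_R` back along the transition is
  `absModelHom_{R'} ∘ (id ⊗ ψ)`** (the base change map is natural in the ring);
* for `ψ` SURJECTIVE and `V` affine: `absTransitionAppLE_surjective` — the pull-back of functions
  `Γ(pr_P⁻¹V × R) → Γ(pr_P⁻¹V × R')` is surjective — and `isNilpotent_ker_absTransitionAppLE` — its
  kernel is nilpotent when `ker ψ` is (`ker_absTransitionAppLE_le`: it is generated by `ker ψ`; Mathlib
  `Algebra.TensorProduct.lTensor_ker`). These are the hypotheses under which frames of line bundles lift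
  from `P × Spec R'` to `P × Spec R` by nilpotent Nakayama (e.g. along `Spec(𝒪/𝔪^{n+1}) ↪ Spec(𝒪/𝔪^{n+2})`).

Everything is proved; no named facts. Mathlib searched (pin): `pullback.map`, `pullback.hom_ext`,
`Scheme.Hom.appLE_comp_appLE`, `Scheme.ΓSpecIso_inv_naturality`, `Algebra.TensorProduct.map_surjective`,
`Algebra.TensorProduct.lTensor_ker`, `Ideal.map_pow` (used).

## References

* The Stacks Project, Tag 02KE (Cohomology of Schemes, Section 30.5: the base change map), Tag 02KG
  (Lemma 30.5.1). [StacksProject]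
* U. Görtz, T. Wedhorn, *Algebraic Geometry I: Schemes*, 2nd ed., Springer Spektrum (2020): Section (4.7),
  pp. 107–108 (base change, transitivity of base change). [GortzWedhorn2020]
* U. Görtz, T. Wedhorn, *Algebraic Geometry II: Cohomology of Schemes*, Springer Spektrum (2023),
  doi:10.1007/978-3-658-43031-3: Lemma 24.72 (p. 409), proof, Step (I) (p. 410). [GortzWedhorn2023]
-/

universe u

open CategoryTheory CategoryTheory.Limits AlgebraicGeometry TopologicalSpace Opposite
open TensorProduct
open Literature.AlgebraicGeometry.Morphisms

noncomputable section

namespace Literature.AlgebraicGeometry.Motives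

section Transition

variable {K : Type u} [Field K] (P : SchemeOver K) {R : Type u} [CommRing R] [Algebra K R]
  (s : Spec (CommRingCat.of R) ⟶ Spec (CommRingCat.of K))
  (hs : s = Spec.map (CommRingCat.ofHom (algebraMap K R)))

/-! ### (α4) Naturality in `R`: change of coefficients -/

variable {R' : Type u} [CommRing R'] [Algebra K R']
  (s' : Spec (CommRingCat.of R') ⟶ Spec (CommRingCat.of K))
  (hs' : s' = Spec.map (CommRingCat.ofHom (algebraMap K R'))) (ψ : R →ₐ[K] R')

include hs hs'

/-- `Spec ψ : Spec R' → Spec R` is a morphism over `Spec K` for a `K`-algebra map `ψ`. [cite: GortzWedhorn2020, Section (4.7) (pp. 107–108)] -/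
theorem Spec_map_comp_eq_of_algHom :
    Spec.map (CommRingCat.ofHom ψ.toRingHom) ≫ s = s' := by
  subst hs hs'
  rw [← Spec.map_comp]
  congr 1
  ext r
  change ψ (algebraMap K R r) = algebraMap K R' r
  exact ψ.commutes r

/-- **The transition morphism `P ×_K Spec R' → P ×_K Spec R`** of a `K`-algebra map `ψ : R → R'`
(`pullback.map` of the identity of `P` and `Spec ψ`); for `ψ = π_n : 𝒪/𝔪^{n+2} → 𝒪/𝔪^{n+1}` this is
the closed immersion of infinitesimal neighbourhoods `X_{n+1} ↪ X_{n+2}`. [cite: GortzWedhorn2020, Section (4.7) (pp. 107–108)] -/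
def absTransition : pullback P.hom s' ⟶ pullback P.hom s :=
  pullback.map P.hom s' P.hom s (𝟙 P.left) (Spec.map (CommRingCat.ofHom ψ.toRingHom)) (𝟙 _)
    (by rw [Category.comp_id, Category.id_comp])
    (by rw [Category.comp_id, Spec_map_comp_eq_of_algHom s hs s' hs' ψ])

/-- The transition morphism commutes with the projections to `P`. [cite: GortzWedhorn2020, Section (4.7) (pp. 107–108)] -/
@[simp, reassoc] theorem absTransition_fst :
    absTransition P s hs s' hs' ψ ≫ pullback.fst P.hom s = pullback.fst P.hom s' := by
  rw [absTransition, pullback.lift_fst, Category.comp_id]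

/-- The transition morphism covers `Spec ψ` on the second projections. [cite: GortzWedhorn2020, Section (4.7) (pp. 107–108)] -/
@[simp, reassoc] theorem absTransition_snd :
    absTransition P s hs s' hs' ψ ≫ pullback.snd P.hom s =
      pullback.snd P.hom s' ≫ Spec.map (CommRingCat.ofHom ψ.toRingHom) := by
  rw [absTransition, pullback.lift_snd]

/-- The transition morphism is a morphism of `K`-schemes (for the `restrictBase` structures).
[cite: GortzWedhorn2020, Section (4.7) (pp. 107–108)] -/
theorem absTransition_comp_restrictBase :
    absTransition P s hs s' hs' ψ ≫ restrictBase K (pullback.snd P.hom s) =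
      restrictBase K (pullback.snd P.hom s') := by
  rw [← fst_comp_eq_restrictBase P s hs, ← fst_comp_eq_restrictBase P s' hs',
    absTransition_fst_assoc]

/-- Preimages under the transition morphism: `τ⁻¹(pr_P⁻¹V) = pr_P'⁻¹V`. [cite: GortzWedhorn2020, Section (4.7) (pp. 107–108)] -/
theorem absTransition_preimage_fst_preimage (V : P.left.Opens) :
    absTransition P s hs s' hs' ψ ⁻¹ᵁ (pullback.fst P.hom s ⁻¹ᵁ V) = pullback.fst P.hom s' ⁻¹ᵁ V := by
  rw [← Scheme.Hom.comp_preimage, absTransition_fst]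

/-- `τ^* ∘ pr_R^* = pr_{R'}^* ∘ ψ` on functions: pulling `pr_R^*(r)` back along the transition
morphism gives `pr_{R'}^*(ψ r)`. [cite: StacksProject, Tag 02KE (Cohomology of Schemes, Section 30.5: the base change map) and Tag 02KG (Lemma 30.5.1)] -/
theorem comap_absTransition_toSectionsBase {W : (pullback P.hom s).Opens}
    {W' : (pullback P.hom s').Opens} (e' : W' ≤ absTransition P s hs s' hs' ψ ⁻¹ᵁ W) (r : R) :
    Sections.comap (restrictBase K (pullback.snd P.hom s)) (restrictBase K (pullback.snd P.hom s'))
        (absTransition P s hs s' hs' ψ) (absTransition_comp_restrictBase P s hs s' hs' ψ) e'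
        (toSectionsBase K (pullback.snd P.hom s) W r) =
      toSectionsBase K (pullback.snd P.hom s') W' (ψ r) := by
  rw [Sections.comap_apply, toSectionsBase_eq_appLE, toSectionsBase_eq_appLE,
    ← CommRingCat.comp_apply, Scheme.Hom.appLE_comp_appLE]
  -- replace `τ ≫ pr_R` by `pr_{R'} ≫ Spec ψ`
  have key : ∀ {φ : pullback P.hom s' ⟶ Spec (CommRingCat.of R)}
      (_ : φ = pullback.snd P.hom s' ≫ Spec.map (CommRingCat.ofHom ψ.toRingHom))
      (h : W' ≤ φ ⁻¹ᵁ ⊤),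
      φ.appLE ⊤ W' h ((Scheme.ΓSpecIso (.of R)).inv r) =
        (pullback.snd P.hom s').appLE ⊤ W' le_top ((Scheme.ΓSpecIso (.of R')).inv (ψ r)) := by
    rintro _ rfl h
    rw [← Scheme.Hom.appLE_comp_appLE _ _ ⊤ ⊤ W' le_top le_top, CommRingCat.comp_apply]
    congr 1
    have hnat := Scheme.ΓSpecIso_inv_naturality (CommRingCat.ofHom ψ.toRingHom)
    have happ : (Spec.map (CommRingCat.ofHom ψ.toRingHom)).appLE ⊤ ⊤ le_top =
        (Spec.map (CommRingCat.ofHom ψ.toRingHom)).appTop := rfl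
    rw [happ]
    exact (CategoryTheory.congr_fun hnat r).symm
  exact key (absTransition_snd P s hs s' hs' ψ) _

/-- **(α4) Naturality of the absolute model in `R`:** pulling `absModelHom_R` back along the
transition morphism of `ψ : R → R'` is `absModelHom_{R'} ∘ (id ⊗ ψ)` (the unit-cocycle calculus'
`coef ψ` is `Algebra.TensorProduct.map (AlgHom.id _ _) ψ`). [cite: StacksProject, Tag 02KE (Cohomology of Schemes, Section 30.5: the base change map) and Tag 02KG (Lemma 30.5.1)] -/
theorem comap_absModelHom {V : P.left.Opens} {W : (pullback P.hom s).Opens}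
    (e : W ≤ pullback.fst P.hom s ⁻¹ᵁ V) {W' : (pullback P.hom s').Opens}
    (e' : W' ≤ absTransition P s hs s' hs' ψ ⁻¹ᵁ W) (e'' : W' ≤ pullback.fst P.hom s' ⁻¹ᵁ V)
    (x : Sections P.hom V ⊗[K] R) :
    Sections.comap (restrictBase K (pullback.snd P.hom s)) (restrictBase K (pullback.snd P.hom s'))
        (absTransition P s hs s' hs' ψ) (absTransition_comp_restrictBase P s hs s' hs' ψ) e'
        (absModelHom P s hs e x) =
      absModelHom P s' hs' e'' (Algebra.TensorProduct.map (AlgHom.id K (Sections P.hom V)) ψ x) := by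
  induction x using TensorProduct.induction_on with
  | zero => simp only [map_zero]
  | add x y hx hy => simp only [map_add, hx, hy]
  | tmul c r =>
    rw [Algebra.TensorProduct.map_tmul, AlgHom.id_apply, absModelHom_tmul, absModelHom_tmul,
      map_mul, comap_absTransition_toSectionsBase, Sections.comap_comp]
    congr 1
    -- `(τ ≫ pr_P)^* = pr_{P'}^*`
    rw [Sections.comap_apply, Sections.comap_apply]
    have key : ∀ {φ : pullback P.hom s' ⟶ P.left} (_ : φ = pullback.fst P.hom s')
        (h : W' ≤ φ ⁻¹ᵁ V), φ.appLE V W' h c = (pullback.fst P.hom s').appLE V W' e'' c := by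
      rintro _ rfl _; rfl
    exact key (absTransition_fst P s hs s' hs' ψ) _

end Transition

/-! ## §5 (γ4b) The transition morphism along a SURJECTIVE `ψ : R → R'` on affine pieces: the pull-back of
functions `Γ(pr_P⁻¹V × R) → Γ(pr_P⁻¹V × R')` is surjective with nilpotent kernel when `ker ψ` is nilpotent -/

section SurjectiveTransition

variable {K : Type u} [Field K] (P : SchemeOver K) {R : Type u} [CommRing R] [Algebra K R]
  (s : Spec (CommRingCat.of R) ⟶ Spec (CommRingCat.of K))
  (hs : s = Spec.map (CommRingCat.ofHom (algebraMap K R)))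
  {R' : Type u} [CommRing R'] [Algebra K R']
  (s' : Spec (CommRingCat.of R') ⟶ Spec (CommRingCat.of K))
  (hs' : s' = Spec.map (CommRingCat.ofHom (algebraMap K R'))) (ψ : R →ₐ[K] R')

/-- `pr_{P'}⁻¹V ≤ τ⁻¹(pr_P⁻¹V)` (in fact equal: `absTransition_preimage_fst_preimage`).
[cite: GortzWedhorn2020, Section (4.7) (pp. 107–108)] -/
theorem fst_preimage_le_absTransition_preimage (V : P.left.Opens) :
    pullback.fst P.hom s' ⁻¹ᵁ V ≤ absTransition P s hs s' hs' ψ ⁻¹ᵁ (pullback.fst P.hom s ⁻¹ᵁ V) :=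
  (absTransition_preimage_fst_preimage P s hs s' hs' ψ V).ge

/-- The pull-back of functions along the transition morphism, on the affine pieces:
`τ^♯ : Γ(pr_P⁻¹V, 𝒪_{P × Spec R}) → Γ(pr_{P'}⁻¹V, 𝒪_{P × Spec R'})` (an abbreviation for the
`appLE` of `absTransition`). [cite: StacksProject, Tag 02KE (Cohomology of Schemes, Section 30.5: the base change map)] -/
abbrev absTransitionAppLE (V : P.left.Opens) :
    Γ(pullback P.hom s, pullback.fst P.hom s ⁻¹ᵁ V) ⟶ Γ(pullback P.hom s', pullback.fst P.hom s' ⁻¹ᵁ V) :=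
  (absTransition P s hs s' hs' ψ).appLE (pullback.fst P.hom s ⁻¹ᵁ V) (pullback.fst P.hom s' ⁻¹ᵁ V)
    (fst_preimage_le_absTransition_preimage P s hs s' hs' ψ V)

/-- `τ^♯ ∘ Φ_R = Φ_{R'} ∘ (id ⊗ ψ)` on the affine pieces (restatement of `comap_absModelHom` for the
whole preimage `pr_P⁻¹V`). [cite: StacksProject, Tag 02KE (Cohomology of Schemes, Section 30.5: the base change map)] -/
theorem absTransitionAppLE_absModelHom (V : P.left.Opens) (x : Sections P.hom V ⊗[K] R) :
    (absTransitionAppLE P s hs s' hs' ψ V) (absModelHom P s hs (le_refl _) x) =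
      absModelHom P s' hs' (le_refl _) (Algebra.TensorProduct.map (AlgHom.id K (Sections P.hom V)) ψ x) :=
  comap_absModelHom P s hs s' hs' ψ (le_refl _) _ (le_refl _) x

include hs in
/-- **(γ4b, ii) For `ψ` surjective and `V` affine, `τ^♯ : Γ(pr_P⁻¹V × R) → Γ(pr_{P'}⁻¹V × R')` is
surjective** (`id_{Γ(V)} ⊗ ψ` is, and both sides are affine models). [cite: StacksProject, Tag 02KG (Cohomology of Schemes, Lemma 30.5.1)] -/
theorem absTransitionAppLE_surjective (hψ : Function.Surjective ψ) {V : P.left.Opens}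
    (hV : IsAffineOpen V) : Function.Surjective (absTransitionAppLE P s hs s' hs' ψ V) := by
  intro z
  obtain ⟨y', rfl⟩ := (absModelHom_bijective P s' hs' hV).2 z
  obtain ⟨y, rfl⟩ := Algebra.TensorProduct.map_surjective (AlgHom.id K (Sections P.hom V)) ψ
    Function.surjective_id hψ y'
  exact ⟨absModelHom P s hs (le_refl _) y, absTransitionAppLE_absModelHom P s hs s' hs' ψ V y⟩

include hs' in
/-- **The kernel of `τ^♯` on an affine piece is generated by `ker ψ`**: for `V` affine and `ψ`
surjective, `ker τ^♯ ≤ (ker ψ) · Γ(pr_P⁻¹V × R)` (image of `ker ψ` under `pr_R^*`; Mathlib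
`Algebra.TensorProduct.lTensor_ker`). [cite: StacksProject, Tag 02KG (Cohomology of Schemes, Lemma 30.5.1)] -/
theorem ker_absTransitionAppLE_le (hψ : Function.Surjective ψ) {V : P.left.Opens} (hV : IsAffineOpen V) :
    RingHom.ker (absTransitionAppLE P s hs s' hs' ψ V).hom ≤
      (RingHom.ker ψ).map (toSectionsBase K (pullback.snd P.hom s) (pullback.fst P.hom s ⁻¹ᵁ V)) := by
  intro z hz
  obtain ⟨y, rfl⟩ := (absModelHom_bijective P s hs hV).2 z
  -- `(id ⊗ ψ) y` lies in the kernel of the bijective model map at `R'`, hence is `0`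
  have hy : Algebra.TensorProduct.map (AlgHom.id K (Sections P.hom V)) ψ y = 0 := by
    apply (absModelHom_bijective P s' hs' hV).1
    rw [map_zero, ← absTransitionAppLE_absModelHom]
    exact hz
  have hy' : y ∈ RingHom.ker (Algebra.TensorProduct.map (AlgHom.id K (Sections P.hom V)) ψ) := hy
  rw [Algebra.TensorProduct.lTensor_ker _ hψ] at hy'
  -- push the generators `1 ⊗ i`, `i ∈ ker ψ`, through the model map: `Φ_R (1 ⊗ i) = pr_R^*(i)`
  have hmap : (RingHom.ker ψ).map (Algebra.TensorProduct.includeRight :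
      R →ₐ[K] Sections P.hom V ⊗[K] R) ≤
      ((RingHom.ker ψ).map (toSectionsBase K (pullback.snd P.hom s) (pullback.fst P.hom s ⁻¹ᵁ V))).comap
        (absModelHom P s hs (le_refl (pullback.fst P.hom s ⁻¹ᵁ V))).toRingHom := by
    rw [Ideal.map_le_iff_le_comap]
    intro i hi
    rw [Ideal.mem_comap, Ideal.mem_comap, AlgHom.toRingHom_eq_coe, RingHom.coe_coe,
      Algebra.TensorProduct.includeRight_apply, absModelHom_one_tmul]
    exact Ideal.mem_map_of_mem _ hi
  exact hmap hy'

include hs' in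
/-- **(γ4b, iii) For `ψ` surjective with nilpotent kernel and `V` affine, `ker τ^♯` is nilpotent**
(e.g. the closed immersions `P × Spec(𝒪/𝔪^{n+1}) ↪ P × Spec(𝒪/𝔪^{n+2})` of infinitesimal neighbourhoods:
the chart algebras pass from `FL n` to `FL (n+1)` by nilpotent Nakayama).
[cite: GortzWedhorn2023, Lemma 24.72 (p. 409), proof, Step (I) (p. 410)] -/
theorem isNilpotent_ker_absTransitionAppLE (hψ : Function.Surjective ψ)
    (hN : IsNilpotent (RingHom.ker ψ)) {V : P.left.Opens} (hV : IsAffineOpen V) :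
    IsNilpotent (RingHom.ker (absTransitionAppLE P s hs s' hs' ψ V).hom) := by
  obtain ⟨m, hm⟩ := hN
  refine ⟨m, le_bot_iff.mp ?_⟩
  calc RingHom.ker (absTransitionAppLE P s hs s' hs' ψ V).hom ^ m
      ≤ ((RingHom.ker ψ).map
          (toSectionsBase K (pullback.snd P.hom s) (pullback.fst P.hom s ⁻¹ᵁ V))) ^ m :=
        Ideal.pow_right_mono (ker_absTransitionAppLE_le P s hs s' hs' ψ hψ hV) m
    _ = ⊥ := by rw [← Ideal.map_pow, hm, Ideal.zero_eq_bot, Ideal.map_bot]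

include hs hs' in
/-- The same two facts for the target open written as `τ⁻¹(pr_P⁻¹V)` (any proof of the inequality).
[cite: StacksProject, Tag 02KG (Cohomology of Schemes, Lemma 30.5.1)] -/
theorem absTransition_appLE_surjective_and_isNilpotent_ker (hψ : Function.Surjective ψ)
    (hN : IsNilpotent (RingHom.ker ψ)) {V : P.left.Opens} (hV : IsAffineOpen V)
    (W' : (pullback P.hom s').Opens) (hW' : W' = pullback.fst P.hom s' ⁻¹ᵁ V)
    (e : W' ≤ absTransition P s hs s' hs' ψ ⁻¹ᵁ (pullback.fst P.hom s ⁻¹ᵁ V)) :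
    Function.Surjective ((absTransition P s hs s' hs' ψ).appLE _ W' e).hom ∧
      IsNilpotent (RingHom.ker ((absTransition P s hs s' hs' ψ).appLE _ W' e).hom) := by
  subst hW'
  exact ⟨absTransitionAppLE_surjective P s hs s' hs' ψ hψ hV,
    isNilpotent_ker_absTransitionAppLE P s hs s' hs' ψ hψ hN hV⟩

end SurjectiveTransition

end Literature.AlgebraicGeometry.Motives

end
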